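import Literature.AlgebraicGeometry.Resolution.SingUnramifiedRing
import Literature.AlgebraicGeometry.Resolution.SmoothBaseChangeField
import Literature.RingTheory.FittingIdeal.Localization
import Mathlib.RingTheory.Smooth.Fiber
import Mathlib.RingTheory.Etale.Descent
import Mathlib.RingTheory.Localization.BaseChange
import HarnessLib

/-!
# Smoothness at a point: through the fibre, and under extension of the base field (Stacks 00TF, 01V8, 02VL)

Topic: `Literature/AlgebraicGeometry/Resolution`. Generic commutative algebra serving the
discharge of the named fact `DeJong1996SmoothIffDifferentialsCyclic`
(`AlterationsSingFitting.lean`; de Jong 1996, 3.1 with 2.21: the smooth locus of a semi-stable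
curve `f : X → S` is the complement of `Sing(f) = V(Fitt₁ Ω_{X/S})`, i.e. The Stacks Project,
Tag 01V9 (1) ⇔ (3) with `dim_x(X_s) = 1`). The reduction of "`f` is smooth at `x`" to a statement
about the GEOMETRIC fibre through `x` has two generic steps, both PROVED here for a finitely
presented algebra and Mathlib's pointwise smoothness `Algebra.IsSmoothAt R 𝔮` (`= R → T_𝔮`
formally smooth):

* `isSmoothAt_comap_iff_isSmoothAt_fiber` — **the fibre criterion at a point** (Stacks 00TF;
  01V8: "Assume `f` is locally of finite presentation, `f` is flat at `x`, and the fibre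
  `X_{f(x)}` is smooth at `x`. Then `f` is smooth at `x`", and conversely by base change): for
  `T` flat and of finite presentation over `R`, a prime `𝔭 ⊂ R` and a prime `𝔮'` of the fibre
  ring `κ(𝔭) ⊗_R T` over `𝔮 ⊂ T`, `T` is `R`-smooth at `𝔮` iff `κ(𝔭) ⊗_R T` is `κ(𝔭)`-smooth at
  `𝔮'`. Mathlib has the local-ring form `Algebra.FormallySmooth.of_formallySmooth_residueField_tensor`
  and the whole-fibre form `Algebra.IsSmoothAt.of_formallySmooth_fiber`; the pointwise form is
  obtained through `(κ(𝔭) ⊗_R T)_{𝔮'} ≅ κ(𝔭) ⊗_{R_𝔭} T_𝔮` (`Ideal.Fiber.localizationAlgEquivQuotient`).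
* `isSmoothAt_iff_forall_isSmoothAt_baseChange` — **smoothness at a point under an algebraic
  extension `K ⊇ κ` of the ground field** (fpqc descent of smoothness, Stacks 02VL, pointwise):
  `F` is `κ`-smooth at `𝔮` iff `K ⊗_κ F` is `K`-smooth at every prime over `𝔮`. Descent: the
  non-smooth locus upstairs is closed with closed image (`F → K ⊗_κ F` is integral), so a basic
  open `D(g) ∋ 𝔮` has `D(1 ⊗ g)` smooth, and `Algebra.Smooth` descends along the faithfully flat
  `κ → K` (Mathlib `Algebra.Smooth.of_smooth_tensorProduct_of_faithfullyFlat`).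
* the bookkeeping of the Jacobian ideal `Fitt_k(Ω)` along both base changes
  (`fittingIdeal_kaehlerDifferential_fiber_le_iff`, `fittingIdeal_kaehlerDifferential_baseChange_le_iff`,
  from `Module.fittingIdeal_kaehlerDifferential_of_isPushout` of `SingUnramifiedRing.lean`,
  Stacks 0C3I), and lying-over for the integral `F → K ⊗_κ F`
  (`RingHom.isIntegral_includeRight_of_isAlgebraic`, `exists_isPrime_over_of_baseChange_field`).

## Sources

* The Stacks Project, Tags 00TF, 01V8 (fibre criterion), 02VL (descent of smoothness), 0C3I
  (formation of `V(Fitt_k Ω)` commutes with base change). [StacksProject]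
* A. J. de Jong, *Smoothness, semi-stability and alterations*, Publ. Math. IHÉS 83 (1996), 2.21,
  3.1 (pp. 61–62). [DeJong1996]
-/

noncomputable section

open IsLocalRing TensorProduct

namespace Literature.AlgebraicGeometry.Resolution

open Literature.RingTheory.FittingIdeal

universe u v w

/-! ## Smoothness at a point is smoothness of the fibre at the point (Stacks 00TF / 01V8) -/

section FibreCriterion

variable {R : Type u} {S : Type v} [CommRing R] [CommRing S] [Algebra R S]

set_option backward.isDefEq.respectTransparency false in
open _root_.Algebra in
/-- **Pointwise fibre criterion of smoothness** (The Stacks Project, Tag 00TF; Tag 01V8: "Assume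
`f` is locally of finite presentation, `f` is flat at `x`, and the fibre `X_{f(x)}` is smooth at
`x`. Then `f` is smooth at `x`", together with the converse, smoothness being stable under base
change). For `S` flat and of finite presentation over `R`, a prime `p ⊂ R` and a prime `q'` of the
fibre ring `κ(p) ⊗_R S` over the prime `q = q' ∩ S`: `S` is `R`-smooth at `q` iff
`κ(p) ⊗_R S` is `κ(p)`-smooth at `q'`. (Mathlib's `Algebra.IsSmoothAt.of_formallySmooth_fiber`
asks the whole fibre to be smooth; the proof here is its pointwise form, through
`(κ(p) ⊗_R S)_{q'} ≅ κ(p) ⊗_{R_p} S_q`, `Ideal.Fiber.localizationAlgEquivQuotient`.)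
[cite: StacksProject, Tag 00TF] -/
theorem isSmoothAt_comap_iff_isSmoothAt_fiber [Algebra.FinitePresentation R S] [Module.Flat R S]
    (p : Ideal R) [p.IsPrime] (q' : Ideal (p.Fiber S)) [q'.IsPrime] :
    Algebra.IsSmoothAt R (q'.comap (Algebra.TensorProduct.includeRight :
        S →ₐ[R] p.Fiber S)) ↔
      Algebra.IsSmoothAt p.ResidueField q' := by
  set q : Ideal S := q'.comap (Algebra.TensorProduct.includeRight : S →ₐ[R] p.Fiber S) with hq
  constructor
  · intro h
    exact isSmoothAt_baseChange p.ResidueField q q' rfl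
  intro h
  -- notation
  let Rp := Localization.AtPrime p
  let Sq := Localization.AtPrime q
  letI := Localization.AtPrime.algebraOfLiesOver p q
  let k := p.ResidueField
  -- `(κ(p) ⊗ S)_{q'} ≃ S_q / p S_q ≃ S_q / 𝔪_p S_q ≃ κ(p) ⊗_{R_p} S_q`, over `R_p`
  let e₁ : Localization.AtPrime q' ≃ₐ[Rp] Sq ⧸ p.map (algebraMap R Sq) :=
    Ideal.Fiber.localizationAlgEquivQuotient p q'
  have hmap : p.map (algebraMap R Sq) = (maximalIdeal Rp).map (algebraMap Rp Sq) := by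
    rw [← Localization.AtPrime.map_eq_maximalIdeal, Ideal.map_map,
      ← IsScalarTower.algebraMap_eq]
  let e₂ : (Sq ⧸ p.map (algebraMap R Sq)) ≃ₐ[Rp] Sq ⧸ (maximalIdeal Rp).map (algebraMap Rp Sq) :=
    Ideal.quotientEquivAlgOfEq Rp hmap
  let e₃ : k ⊗[Rp] Sq ≃ₐ[Rp] Sq ⧸ (maximalIdeal Rp).map (algebraMap Rp Sq) :=
    (Algebra.TensorProduct.comm _ _ _).trans
      ((Algebra.TensorProduct.quotIdealMapEquivTensorQuot Sq (maximalIdeal Rp)).symm.restrictScalars _)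
  let E : Localization.AtPrime q' ≃ₐ[Rp] k ⊗[Rp] Sq := e₁.trans (e₂.trans e₃.symm)
  -- `E` is `κ(p)`-linear (`R_p → κ(p)` is onto)
  have hE : ∀ (c : k) (x : Localization.AtPrime q'), E (c • x) = c • E x := by
    intro c x
    obtain ⟨r, rfl⟩ := IsLocalRing.residue_surjective c
    rw [← ResidueField.algebraMap_eq, algebraMap_smul, algebraMap_smul, map_smul]
  have h1 : ∀ c : k, E (algebraMap k _ c) = algebraMap k _ c := by
    intro c
    rw [Algebra.algebraMap_eq_smul_one, hE, map_one, Algebra.algebraMap_eq_smul_one]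
  let E' : Localization.AtPrime q' ≃ₐ[k] k ⊗[Rp] Sq :=
    { E with
      commutes' := fun c => by
        have := h1 c
        exact this }
  haveI : Algebra.FormallySmooth k (Localization.AtPrime q') := h
  haveI : Algebra.FormallySmooth k (k ⊗[Rp] Sq) :=
    Algebra.FormallySmooth.of_equiv (A := Localization.AtPrime q') E'
  -- `S_q` is a localization of the finitely presented `R_p`-algebra `S_p`
  let Sp := Localization (algebraMapSubmonoid S p.primeCompl)
  let f : Sp →ₐ[S] Sq := IsLocalization.liftAlgHom (M := algebraMapSubmonoid S p.primeCompl)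
        (f := Algebra.ofId _ _) (by
      rintro ⟨_, x, hx, rfl⟩
      simpa using! IsLocalization.map_units (M := q.primeCompl) Sq ⟨algebraMap _ _ x,
        by simp_all [q.over_def p]⟩)
  algebraize [f.toRingHom]
  have : IsScalarTower R Sp Sq := .to₁₃₄ _ S _ _
  have : IsScalarTower Rp Sp Sq := .of_algebraMap_eq' <| by
    apply IsLocalization.ringHom_ext p.primeCompl
    simp only [RingHom.comp_assoc, ← IsScalarTower.algebraMap_eq]
  have : IsLocalization (algebraMapSubmonoid Sp q.primeCompl) Sq :=
    .isLocalization_of_submonoid_le _ _ (algebraMapSubmonoid S p.primeCompl) _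
    (by rintro _ ⟨x, hx, rfl⟩; simp_all [q.over_def p])
  have : Algebra.FinitePresentation Rp Sp := by
    have : Algebra.IsPushout R Rp S Sp :=
      .symm <| Algebra.isPushout_of_isLocalization p.primeCompl _ _ _
    exact .equiv (Algebra.IsPushout.equiv R Rp S Sp)
  have := Algebra.FormallySmooth.of_formallySmooth_residueField_tensor
    (R := Rp) (S := Sq) (P := Sp) (algebraMapSubmonoid _ q.primeCompl)
  exact Algebra.FormallySmooth.comp R Rp Sq

/-- **The Jacobian ideal through the fibre**: with `J = Fitt₁(Ω_{S/R})` (any `k`), the `k`-th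
Fitting ideal of `Ω` of the fibre `κ(p) ⊗_R S` over `κ(p)` is `J · (κ(p) ⊗_R S)`, so it lies in a
prime `q'` of the fibre iff `J ⊆ q' ∩ S`. [cite: StacksProject, Tag 0C3I] -/
theorem fittingIdeal_kaehlerDifferential_fiber_le_iff [Algebra.FiniteType R S]
    (p : Ideal R) [p.IsPrime] (q' : Ideal (p.Fiber S)) (k : ℕ) :
    Module.fittingIdeal (p.Fiber S) Ω[p.Fiber S⁄p.ResidueField] k ≤ q' ↔
      Module.fittingIdeal S Ω[S⁄R] k ≤
        q'.comap (Algebra.TensorProduct.includeRight : S →ₐ[R] p.Fiber S) := by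
  letI : Algebra S (p.Fiber S) := Algebra.TensorProduct.rightAlgebra
  rw [Module.fittingIdeal_kaehlerDifferential_of_isPushout R p.ResidueField S (p.Fiber S) k,
    Ideal.map_le_iff_le_comap]
  rfl

end FibreCriterion

/-! ## Smoothness at a point under extension of the base field -/

section FieldExtension

variable {κ : Type u} {K : Type v} [Field κ] [Field K] [Algebra κ K]
variable {F : Type w} [CommRing F] [Algebra κ F]

/-- For an algebraic extension `K ⊇ κ` and a `κ`-algebra `F`, `F → K ⊗_κ F` is integral (the
`F`-algebra structure on `K ⊗_κ F` is Mathlib's `rightAlgebra`, not an instance). [folklore] -/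
theorem RingHom.isIntegral_includeRight_of_isAlgebraic [Algebra.IsAlgebraic κ K] :
    (Algebra.TensorProduct.includeRight : F →ₐ[κ] K ⊗[κ] F).toRingHom.IsIntegral := by
  letI : Algebra F (K ⊗[κ] F) := Algebra.TensorProduct.rightAlgebra
  intro x
  change IsIntegral F x
  induction x using TensorProduct.induction_on with
  | zero => exact isIntegral_zero
  | tmul c f =>
    have h1 : IsIntegral F ((c ⊗ₜ[κ] (1 : F)) : K ⊗[κ] F) := by
      have hc : IsIntegral κ c := Algebra.IsIntegral.isIntegral c
      exact (hc.map (Algebra.TensorProduct.includeLeft : K →ₐ[κ] K ⊗[κ] F)).tower_top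
    have h2 : IsIntegral F ((1 : K) ⊗ₜ[κ] f : K ⊗[κ] F) := isIntegral_algebraMap
    have := h1.mul h2
    rwa [Algebra.TensorProduct.tmul_mul_tmul, one_mul, mul_one] at this
  | add x y hx hy => exact hx.add hy

/-- Every prime of `F` lies under a prime of `K ⊗_κ F` (`F → K ⊗_κ F` is injective and integral
for `K ⊇ κ` algebraic). [folklore] -/
theorem exists_isPrime_over_of_baseChange_field [Algebra.IsAlgebraic κ K] (q : Ideal F) [q.IsPrime] :
    ∃ Q : Ideal (K ⊗[κ] F), Q.IsPrime ∧
      Q.comap (Algebra.TensorProduct.includeRight : F →ₐ[κ] K ⊗[κ] F) = q := by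
  letI : Algebra F (K ⊗[κ] F) := Algebra.TensorProduct.rightAlgebra
  haveI : Algebra.IsIntegral F (K ⊗[κ] F) :=
    ⟨RingHom.isIntegral_includeRight_of_isAlgebraic (κ := κ) (K := K) (F := F)⟩
  have hinj : Function.Injective (algebraMap F (K ⊗[κ] F)) :=
    Algebra.TensorProduct.includeRight_injective (algebraMap κ K).injective
  have hbot : (⊥ : Ideal (K ⊗[κ] F)).comap (algebraMap F (K ⊗[κ] F)) ≤ q := by
    rw [Ideal.comap_bot_of_injective _ hinj]
    exact bot_le
  obtain ⟨Q, -, hQ, hQq⟩ := Ideal.exists_ideal_over_prime_of_isIntegral q ⊥ hbot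
  exact ⟨Q, hQ, hQq⟩

/-- **Smoothness at a point descends along an extension of the base field** (fpqc descent of
smoothness, The Stacks Project, Tag 02VL, in the pointwise form): for `F` of finite presentation
over the field `κ`, an algebraic extension `K ⊇ κ` and a prime `q ⊂ F`, if `K ⊗_κ F` is
`K`-smooth at every prime over `q`, then `F` is `κ`-smooth at `q`. Proof: the non-smooth locus
`Z` of `K ⊗_κ F` is closed and `Spec(K ⊗_κ F) → Spec F` is closed (integral), so some basic open
`D(g) ∋ q` has `D(1 ⊗ g)` inside the smooth locus; then `(K ⊗_κ F)_{1 ⊗ g} = K ⊗_κ F_g` is smooth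
over `K` and smoothness of `F_g` descends along the faithfully flat `κ → K` (Mathlib
`Algebra.Smooth.of_smooth_tensorProduct_of_faithfullyFlat`). [cite: StacksProject, Tag 02VL] -/
theorem isSmoothAt_of_forall_isSmoothAt_baseChange [Algebra.FinitePresentation κ F]
    [Algebra.IsAlgebraic κ K] (q : Ideal F) [q.IsPrime]
    (h : ∀ (Q : Ideal (K ⊗[κ] F)) [Q.IsPrime],
      Q.comap (Algebra.TensorProduct.includeRight : F →ₐ[κ] K ⊗[κ] F) = q →
        Algebra.IsSmoothAt K Q) :
    Algebra.IsSmoothAt κ q := by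
  classical
  letI : Algebra F (K ⊗[κ] F) := Algebra.TensorProduct.rightAlgebra
  let i : F →ₐ[κ] K ⊗[κ] F := Algebra.TensorProduct.includeRight
  -- `Spec (K ⊗ F) → Spec F` is a closed map
  have hint : (algebraMap F (K ⊗[κ] F)).IsIntegral :=
    RingHom.isIntegral_includeRight_of_isAlgebraic (κ := κ) (K := K) (F := F)
  have hclosed : IsClosedMap (PrimeSpectrum.comap (algebraMap F (K ⊗[κ] F))) :=
    PrimeSpectrum.isClosedMap_comap_of_isIntegral _ hint
  -- the non-smooth locus upstairs and its (closed) image, which misses `q`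
  let Z : Set (PrimeSpectrum (K ⊗[κ] F)) := (Algebra.smoothLocus K (K ⊗[κ] F))ᶜ
  have hZ : IsClosed Z := Algebra.isOpen_smoothLocus.isClosed_compl
  have hqZ : (⟨q, ‹_›⟩ : PrimeSpectrum F) ∈ (PrimeSpectrum.comap (algebraMap F (K ⊗[κ] F)) '' Z)ᶜ := by
    rintro ⟨Q, hQZ, hQq⟩
    apply hQZ
    have hQq' : Q.asIdeal.comap i = q := congrArg PrimeSpectrum.asIdeal hQq
    exact h Q.asIdeal hQq'
  obtain ⟨_, ⟨g, rfl⟩, hqg, hgZ⟩ :=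
    PrimeSpectrum.isTopologicalBasis_basic_opens.exists_subset_of_mem_open hqZ
      (hclosed Z hZ).isOpen_compl
  -- `D(1 ⊗ g)` lies in the smooth locus
  have hsub : ↑(PrimeSpectrum.basicOpen (i g)) ⊆ Algebra.smoothLocus K (K ⊗[κ] F) := by
    intro Q hQ
    by_contra hQ'
    have hmem : PrimeSpectrum.comap (algebraMap F (K ⊗[κ] F)) Q ∈
        (PrimeSpectrum.basicOpen g : Set (PrimeSpectrum F)) := hQ
    exact hgZ hmem ⟨Q, hQ', rfl⟩
  have hsmK : Algebra.Smooth K (Localization.Away (i g)) :=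
    Algebra.basicOpen_subset_smoothLocus_iff_smooth.mp hsub
  -- `(K ⊗ F)_{1 ⊗ g} ≅ K ⊗ F_g`, so `F_g` is smooth by faithfully flat descent
  let C := Localization.Away (i g)
  have hmap : (Submonoid.powers g).map i = Submonoid.powers (i g) := Submonoid.map_powers _ g
  haveI : IsLocalization ((Submonoid.powers g).map i) C := by
    rw [hmap]
    infer_instance
  let e : K ⊗[κ] Localization.Away g ≃ₐ[K] C :=
    IsLocalization.tensorProductEquivOfMapIncludeRight κ K (.powers g) (Localization.Away g) C
  haveI : Algebra.Smooth K C := hsmK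
  haveI : Algebra.Smooth K (K ⊗[κ] Localization.Away g) := .of_equiv e.symm
  haveI : Algebra.Smooth κ (Localization.Away g) :=
    Algebra.Smooth.of_smooth_tensorProduct_of_faithfullyFlat K
  exact Algebra.basicOpen_subset_smoothLocus_iff_smooth.mpr ‹_› hqg

/-- **Smoothness at a point is insensitive to algebraic extension of the base field**: for `F`
of finite presentation over `κ`, `K ⊇ κ` algebraic and a prime `q ⊂ F`, `F` is `κ`-smooth at `q`
iff `K ⊗_κ F` is `K`-smooth at every prime over `q` (base change, and the descent above).
[cite: StacksProject, Tag 02VL] -/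
theorem isSmoothAt_iff_forall_isSmoothAt_baseChange [Algebra.FinitePresentation κ F]
    [Algebra.IsAlgebraic κ K] (q : Ideal F) [q.IsPrime] :
    Algebra.IsSmoothAt κ q ↔ ∀ (Q : Ideal (K ⊗[κ] F)) [Q.IsPrime],
      Q.comap (Algebra.TensorProduct.includeRight : F →ₐ[κ] K ⊗[κ] F) = q →
        Algebra.IsSmoothAt K Q :=
  ⟨fun _ Q _ hQ => isSmoothAt_baseChange K q Q hQ, isSmoothAt_of_forall_isSmoothAt_baseChange q⟩

/-- **The Jacobian ideal under extension of the base field**: `Fitt_k(Ω_{K ⊗ F/K}) =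
Fitt_k(Ω_{F/κ}) · (K ⊗_κ F)`, so it lies in a prime `Q` iff `Fitt_k(Ω_{F/κ}) ⊆ Q ∩ F`.
[cite: StacksProject, Tag 0C3I] -/
theorem fittingIdeal_kaehlerDifferential_baseChange_le_iff [Algebra.FiniteType κ F]
    (Q : Ideal (K ⊗[κ] F)) (k : ℕ) :
    Module.fittingIdeal (K ⊗[κ] F) Ω[K ⊗[κ] F⁄K] k ≤ Q ↔
      Module.fittingIdeal F Ω[F⁄κ] k ≤
        Q.comap (Algebra.TensorProduct.includeRight : F →ₐ[κ] K ⊗[κ] F) := by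
  letI : Algebra F (K ⊗[κ] F) := Algebra.TensorProduct.rightAlgebra
  rw [Module.fittingIdeal_kaehlerDifferential_of_isPushout κ K F (K ⊗[κ] F) k,
    Ideal.map_le_iff_le_comap]
  rfl

end FieldExtension

end Literature.AlgebraicGeometry.Resolution

end
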